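import Summits.Ventures.PercRepro.PendantClass
import Summits.Ventures.PercRepro.Reach
import Summits.Ventures.PercRepro.LineCMinFace

/-!
# PercRepro — `(5a)_class` IS pendant-mark contraction monotonicity: the (H) identity (typer-2, gen 5)

p1 (`proofs/P1-census-g3.md` §O–§P, verified exactly on 9,720 + 72,520 instances): for a PENDANT MARK `a`
with its edge `g = a–h`, the class-level pendant Lemma 5a is the same statement as «moving the mark `a` back
along `g` does not increase the Lemma-B⁺ class sum»: (H) `CS(G; a,b,c,d) ≥ CS(G/g; h,b,c,d)`. This file proves
the identity behind it in the kernel, on the full cube of `G`: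

  **`classSum g ![a,b,c,d] ⊤ ⊥ = 2·CS(G; a,b,c,d) − CS₁(G, g; a,b,c,d)`**

where `CS = cubeSumC011` (the ordered full-cube C-011 class sum) and `CS₁ = cubeSumC011Con` is the same sum
for the map `ρ ↦ row4 Π(ρ[g := 1])` (the contraction `G/g` with the mark at `h`, read on the full cube — it
counts every configuration of `G/g` twice, so `CS₁ = 2·CS(G/g)` in p1's normalisation). Hence

  **`PendantClassSumNonneg ⟺ ∀ pendant (G, g, a, b, c, d), CS₁ ≤ 2·CS`**, i.e. `(5a)_class ⟺ (H)`.

The mechanism: the merge vector along `g` is `e_{c₁ ρ} − e_{c₀ ρ}` with `c₁ ρ = row4 Π(ρ[g:=1])`,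
`c₀ ρ = row4 Π(ρ[g:=0])`; `Q⁺` on such differences is the kernel `kplus = K⁺ + K⁺ᵀ` (`quadPlus_basis`); the full
cube splits along `g` into the two facets (`cubeSum_eq_crossSum_facets`), on which `c₁` and `c₀` are the two
facet maps `f₁`, `f₀`; and the `(c₀, c₀)` term vanishes because with `g` closed the pendant mark `a` is a
singleton of the partition, whose rows never carry the kernel (`phiPlusKernel_row4_eq_zero_of_isolated`).

* `kplusZ_eq_zero_of_ne`, `rowOf4_ne_of_isolated_aux` (64 cases), `row4_ne_of_isolated`,
  **`phiPlusKernel_row4_eq_zero_of_isolated`**; `kplus_eq_kplusZ_add` (`kplus = K⁺ + K⁺ᵀ`, 225 cases);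
* `MultiGraph.isolated_of_closed_pendant` (a mark whose only edge is closed is its own cluster);
* `faceEquivTop`, **`MultiGraph.classSum_top_bot_eq_sum`** (the full-cube class sum as a sum over `Config E`);
* **`MultiGraph.cubeSumC011Con`**, `cubeSumC011Con_eq_facets`, `cubeSumC011_eq_facets`;
* **`MultiGraph.classSum_top_bot_eq_of_pendant`** — the (H) identity;
* **`pendantClassSumNonneg_iff`** — `(5a)_class ⟺ (H)`.
-/

namespace PercRepro

open Finset

/-! ### Rows with a singleton first index never carry the kernel -/

/-- `K⁺(s, t) = 0` unless `s` is `⊤` or a crossing row (225 cases). -/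
theorem kplusZ_eq_zero_of_ne : ∀ s t : Fin 15, s ≠ 0 → s ≠ 3 → s ≠ 6 → s ≠ 8 → kplusZ s t = 0 := by
  decide

/-- An atom vector with `0` isolated (`01, 02, 03` all false) never gives `⊤` or a crossing row
(64 cases). -/
theorem rowOf4_ne_of_isolated_aux : ∀ b0 b1 b2 b3 b4 b5 : Bool,
    IsEquivAtoms4 ![b0, b1, b2, b3, b4, b5] → b0 = false → b1 = false → b2 = false →
      rowOf4 ![b0, b1, b2, b3, b4, b5] ≠ 0 ∧ rowOf4 ![b0, b1, b2, b3, b4, b5] ≠ 3 ∧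
        rowOf4 ![b0, b1, b2, b3, b4, b5] ≠ 6 ∧ rowOf4 ![b0, b1, b2, b3, b4, b5] ≠ 8 := by
  decide

open Classical in
/-- The row of a partition in which `0` is a singleton is neither `⊤` nor crossing. -/
theorem row4_ne_of_isolated (σ : Setoid (Fin 4)) (h1 : ¬ σ 0 1) (h2 : ¬ σ 0 2) (h3 : ¬ σ 0 3) :
    row4 σ ≠ 0 ∧ row4 σ ≠ 3 ∧ row4 σ ≠ 6 ∧ row4 σ ≠ 8 := by
  have hv := isEquivAtoms4_atoms4 σ
  have ha : atoms4 σ 0 = false := decide_eq_false h1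
  have hb : atoms4 σ 1 = false := decide_eq_false h2
  have hc : atoms4 σ 2 = false := decide_eq_false h3
  unfold row4
  rw [vec6_eta (atoms4 σ)] at hv ⊢
  exact rowOf4_ne_of_isolated_aux _ _ _ _ _ _ hv ha hb hc

/-- **The kernel vanishes on rows with `0` isolated**: `K⁺(row4 σ, t) = 0` when `0` is a singleton of `σ`. -/
theorem phiPlusKernel_row4_eq_zero_of_isolated (σ : Setoid (Fin 4)) (h1 : ¬ σ 0 1) (h2 : ¬ σ 0 2)
    (h3 : ¬ σ 0 3) (t : Fin 15) : phiPlusKernel (row4 σ) t = 0 := by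
  obtain ⟨n0, n3, n6, n8⟩ := row4_ne_of_isolated σ h1 h2 h3
  rw [phiPlusKernel_eq_kplusZ, kplusZ_eq_zero_of_ne _ t n0 n3 n6 n8]
  exact Int.cast_zero

/-- The integer kernel of `2·Q⁺` is the symmetrised C-011 kernel: `kplus s t = K⁺(s, t) + K⁺(t, s)`
(225 cases). -/
theorem kplus_eq_kplusZ_add : ∀ s t : Fin 15, kplus s t = kplusZ s t + kplusZ t s := by
  decide

/-- … as real numbers. -/
theorem kplus_eq_phiPlusKernel_add (s t : Fin 15) :
    (kplus s t : ℝ) = phiPlusKernel s t + phiPlusKernel t s := by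
  rw [phiPlusKernel_eq_kplusZ, phiPlusKernel_eq_kplusZ, kplus_eq_kplusZ_add, Int.cast_add]

/-! ### The full-cube class sum as a sum over `Config E` -/

section FullCube

variable {E : Type*}

/-- The face cube of the full interval `[⊥, ⊤]` is the cube itself. -/
def faceEquivTop : Config (Face (fun _ : E => true) (fun _ : E => false)) ≃ Config E where
  toFun ρ := embed (fun _ => true) (fun _ => false) ρ
  invFun σ := restrict (fun _ => true) (fun _ => false) σ
  left_inv ρ := restrict_embed _ _ ρ
  right_inv σ := by
    funext e
    exact embed_apply_of_mem _ _ _ ⟨rfl, rfl⟩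

/-- On the full interval, `embed` commutes with complementation. -/
theorem embed_top_compl (ρ : Config (Face (fun _ : E => true) (fun _ : E => false))) :
    embed (fun _ => true) (fun _ => false) ρᶜ = (embed (fun _ => true) (fun _ => false) ρ)ᶜ := by
  funext e
  rw [Pi.compl_apply, embed_apply_of_mem _ _ _ ⟨rfl, rfl⟩, embed_apply_of_mem _ _ _ ⟨rfl, rfl⟩]
  rfl

end FullCube

namespace MultiGraph

variable {V E : Type*} (G : MultiGraph V E) [Fintype E] [DecidableEq E]

/-- **The full-cube class sum as a sum over `Config E`.** -/
theorem classSum_top_bot_eq_sum (g : E) (m : Fin 4 → V) :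
    G.classSum g m (fun _ => true) (fun _ => false) =
      -∑ σ : Config E, quadPlus (G.mergeVecM g m σ) (G.mergeVecM g m σᶜ) := by
  unfold classSum
  congr 1
  refine Fintype.sum_equiv faceEquivTop _ _ fun ρ => ?_
  show quadPlus (G.mergeVecM g m (embed (fun _ => true) (fun _ => false) ρ))
      (G.mergeVecM g m (embed (fun _ => true) (fun _ => false) ρᶜ)) =
    quadPlus (G.mergeVecM g m (embed (fun _ => true) (fun _ => false) ρ))
      (G.mergeVecM g m (embed (fun _ => true) (fun _ => false) ρ)ᶜ)
  rw [embed_top_compl]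

omit [Fintype E] in
/-- The merge vector is the difference of the two row vectors. -/
theorem mergeVecM_eq_rowVec (g : E) (m : Fin 4 → V) (ω : Config E) :
    G.mergeVecM g m ω = fun r => rowVec (row4 (G.markedPartition (Function.update ω g true) m)) r -
      rowVec (row4 (G.markedPartition (Function.update ω g false) m)) r := rfl

omit [Fintype E] [DecidableEq E] in
/-- **A mark whose only edge is closed is its own cluster.** -/
theorem isolated_of_closed_pendant {ω : Config E} {g : E} {a : V} (hg : ω g = false)
    (hpend : ∀ e, (G.fst e = a ∨ G.snd e = a) → e = g) {x : V} (h : G.Conn ω a x) : a = x := by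
  rcases Relation.ReflTransGen.cases_head h with heq | ⟨y, hay, -⟩
  · exact heq
  · obtain ⟨e, he, hend⟩ := hay
    have hea : G.fst e = a ∨ G.snd e = a := by
      rcases hend with ⟨h1, -⟩ | ⟨-, h2⟩
      · exact Or.inl h1
      · exact Or.inr h2
    rw [hpend e hea, hg] at he
    exact absurd he Bool.false_ne_true

omit [Fintype E] in
/-- The kernel vanishes on the `g`-closed rows of a pendant mark (`a = m 0`). -/
theorem phiPlusKernel_closed_eq_zero {g : E} {a b c d : V} (hab : a ≠ b) (hac : a ≠ c) (had : a ≠ d)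
    (hpend : ∀ e, (G.fst e = a ∨ G.snd e = a) → e = g) (ω : Config E) (t : Fin 15) :
    phiPlusKernel (row4 (G.markedPartition (Function.update ω g false) ![a, b, c, d])) t = 0 := by
  have hg : Function.update ω g false g = false := Function.update_self g false ω
  refine phiPlusKernel_row4_eq_zero_of_isolated _ ?_ ?_ ?_ t
  · intro h
    exact hab (G.isolated_of_closed_pendant hg hpend ((G.markedPartition_rel _ _ 0 1).1 h))
  · intro h
    exact hac (G.isolated_of_closed_pendant hg hpend ((G.markedPartition_rel _ _ 0 2).1 h))
  · intro h
    exact had (G.isolated_of_closed_pendant hg hpend ((G.markedPartition_rel _ _ 0 3).1 h))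

/-- **The contracted class sum `CS₁(G, g)`**: the C-011 cube sum of `ρ ↦ row4 Π(ρ[g := 1])` on the FULL
cube of `G` (every configuration of `G/g` counted twice: `CS₁ = 2·CS(G/g)`). -/
noncomputable def cubeSumC011Con (g : E) (m : Fin 4 → V) : ℝ :=
  cubeSum phiPlusKernel fun ρ => row4 (G.markedPartition (Function.update ρ g true) m)

end MultiGraph

/-- Updating the distinguished coordinate of an extension replaces the bit. -/
theorem update_extendAt {S : Type*} [DecidableEq S] (k : S) (b b' : Bool) (ρ : Config {s // s ≠ k}) :
    Function.update (extendAt k b ρ) k b' = extendAt k b' ρ := by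
  funext s
  by_cases hs : s = k
  · subst hs
    rw [Function.update_self, extendAt_self]
  · rw [Function.update_of_ne hs, extendAt_of_ne k b ρ hs, extendAt_of_ne k b' ρ hs]

/-- The symmetrised cross sum: `Σ_ρ kplus (f ρ) (f′ ρᶜ) = X_{K⁺}(f, f′) + X_{K⁺}(f′, f)`. -/
theorem sum_kplus_eq_crossSum_add {S : Type*} [Fintype S] [DecidableEq S] (f f' : Config S → Fin 15) :
    ∑ ρ : Config S, (kplus (f ρ) (f' ρᶜ) : ℝ) = crossSum phiPlusKernel f f' + crossSum phiPlusKernel f' f := by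
  unfold crossSum
  simp only [kplus_eq_phiPlusKernel_add, Finset.sum_add_distrib]
  congr 1
  refine Fintype.sum_equiv (complPerm (S := S)) _ _ fun ρ => ?_
  simp only [complPerm, Function.Involutive.coe_toPerm, compl_compl]

namespace MultiGraph

variable {V E : Type*} (G : MultiGraph V E) [Fintype E] [DecidableEq E]

/-- The two facet maps at `g` of the row map, `f_b ρ = row4 Π(ρ with g := b)`. -/
noncomputable abbrev facetRow (g : E) (m : Fin 4 → V) (b : Bool) : Config {e // e ≠ g} → Fin 15 :=
  fun ρ => row4 (G.markedPartition (extendAt g b ρ) m)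

/-- A sum over the full cube of a function of `(ρ[g:=b], ρᶜ[g:=b′])` is twice the facet sum. -/
theorem sum_update_eq_two_mul (g : E) (m : Fin 4 → V) (b b' : Bool) (F : Fin 15 → Fin 15 → ℝ) :
    ∑ σ : Config E, F (row4 (G.markedPartition (Function.update σ g b) m))
        (row4 (G.markedPartition (Function.update σᶜ g b') m)) =
      2 * ∑ ρ : Config {e // e ≠ g}, F (G.facetRow g m b ρ) (G.facetRow g m b' ρᶜ) := by
  rw [sum_config_eq_facets g, two_mul]
  congr 1
  · refine Finset.sum_congr rfl fun ρ _ => ?_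
    simp only [compl_extendAt, update_extendAt, facetRow]
  · refine Finset.sum_congr rfl fun ρ _ => ?_
    simp only [compl_extendAt, update_extendAt, facetRow]

/-- `CS(G)` through the two facets at `g`. -/
theorem cubeSumC011_eq_facets (g : E) (m : Fin 4 → V) :
    G.cubeSumC011 m = crossSum phiPlusKernel (G.facetRow g m false) (G.facetRow g m true) +
      crossSum phiPlusKernel (G.facetRow g m true) (G.facetRow g m false) := by
  unfold cubeSumC011
  rw [cubeSum_eq_crossSum_facets phiPlusKernel _ g]
  rfl

/-- `CS₁(G, g)` through the facets: both facets of the contracted map are `f₁`. -/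
theorem cubeSumC011Con_eq_facets (g : E) (m : Fin 4 → V) :
    G.cubeSumC011Con g m = 2 * crossSum phiPlusKernel (G.facetRow g m true) (G.facetRow g m true) := by
  unfold cubeSumC011Con
  rw [cubeSum_eq_crossSum_facets phiPlusKernel _ g, two_mul]
  congr 1
  · unfold crossSum facetBot facetTop facetRow
    refine Finset.sum_congr rfl fun ρ _ => ?_
    simp only [update_extendAt]
  · unfold crossSum facetBot facetTop facetRow
    refine Finset.sum_congr rfl fun ρ _ => ?_
    simp only [update_extendAt]

/-- **THE (H) IDENTITY**: for a pendant mark `a` (its only edge is `g`), the full-cube class sum of the Lemma-5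
kernel along `g` is `2·CS(G; a,b,c,d) − CS₁(G, g; a,b,c,d)`. -/
theorem classSum_top_bot_eq_of_pendant (g : E) (a b c d : V) (hab : a ≠ b) (hac : a ≠ c) (had : a ≠ d)
    (hpend : ∀ e, (G.fst e = a ∨ G.snd e = a) → e = g) :
    G.classSum g ![a, b, c, d] (fun _ => true) (fun _ => false) =
      2 * G.cubeSumC011 ![a, b, c, d] - G.cubeSumC011Con g ![a, b, c, d] := by
  -- the class sum as a kernel sum over the full cube
  rw [G.classSum_top_bot_eq_sum]
  have hq : ∀ σ : Config E, quadPlus (G.mergeVecM g ![a, b, c, d] σ) (G.mergeVecM g ![a, b, c, d] σᶜ) =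
      (1 / 2 : ℝ) *
        ((kplus (row4 (G.markedPartition (Function.update σ g true) ![a, b, c, d]))
            (row4 (G.markedPartition (Function.update σᶜ g true) ![a, b, c, d])) : ℝ) -
          kplus (row4 (G.markedPartition (Function.update σ g true) ![a, b, c, d]))
            (row4 (G.markedPartition (Function.update σᶜ g false) ![a, b, c, d])) -
          kplus (row4 (G.markedPartition (Function.update σ g false) ![a, b, c, d]))
            (row4 (G.markedPartition (Function.update σᶜ g true) ![a, b, c, d])) +
          kplus (row4 (G.markedPartition (Function.update σ g false) ![a, b, c, d]))
            (row4 (G.markedPartition (Function.update σᶜ g false) ![a, b, c, d]))) := by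
    intro σ
    rw [G.mergeVecM_eq_rowVec, G.mergeVecM_eq_rowVec, quadPlus_basis]
  simp only [hq, ← Finset.mul_sum, Finset.sum_sub_distrib, Finset.sum_add_distrib]
  -- each of the four sums over the full cube is twice a facet sum
  rw [G.sum_update_eq_two_mul g ![a, b, c, d] true true (fun s t => (kplus s t : ℝ)),
    G.sum_update_eq_two_mul g ![a, b, c, d] true false (fun s t => (kplus s t : ℝ)),
    G.sum_update_eq_two_mul g ![a, b, c, d] false true (fun s t => (kplus s t : ℝ)),
    G.sum_update_eq_two_mul g ![a, b, c, d] false false (fun s t => (kplus s t : ℝ))]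
  simp only [sum_kplus_eq_crossSum_add]
  -- the `(c₀, c₀)` term vanishes: with `g` closed the pendant mark is isolated
  have h00 : crossSum phiPlusKernel (G.facetRow g ![a, b, c, d] false) (G.facetRow g ![a, b, c, d] false) = 0 := by
    unfold crossSum facetRow
    refine Finset.sum_eq_zero fun ρ _ => ?_
    rw [← update_extendAt g true false ρ]
    exact G.phiPlusKernel_closed_eq_zero hab hac had hpend _ _
  rw [G.cubeSumC011_eq_facets g, G.cubeSumC011Con_eq_facets g, h00]
  ring

end MultiGraph

/-- **`(5a)_class ⟺ (H)`**: the class-level pendant Lemma 5a is exactly pendant-mark contraction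
monotonicity of the C-011 class sum, `CS₁(G, g) ≤ 2·CS(G)` (i.e. `CS(G/g) ≤ CS(G)` in p1's normalisation)
for every pendant mark. -/
theorem pendantClassSumNonneg_iff :
    PendantClassSumNonneg ↔
      ∀ {V E : Type} [Fintype E] [DecidableEq E] (G : MultiGraph V E) (g : E) (a b c d : V),
        [a, b, c, d].Nodup → (G.fst g = a ∨ G.snd g = a) → (∀ e, (G.fst e = a ∨ G.snd e = a) → e = g) →
          G.cubeSumC011Con g ![a, b, c, d] ≤ 2 * G.cubeSumC011 ![a, b, c, d] := by
  have key : ∀ {V E : Type} [Fintype E] [DecidableEq E] (G : MultiGraph V E) (g : E) (a b c d : V),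
      [a, b, c, d].Nodup → (∀ e, (G.fst e = a ∨ G.snd e = a) → e = g) →
        G.classSum g ![a, b, c, d] (fun _ => true) (fun _ => false) =
          2 * G.cubeSumC011 ![a, b, c, d] - G.cubeSumC011Con g ![a, b, c, d] := by
    intro V E _ _ G g a b c d hn hpend
    have hab : a ≠ b := by simp only [List.nodup_cons, List.mem_cons] at hn; tauto
    have hac : a ≠ c := by simp only [List.nodup_cons, List.mem_cons] at hn; tauto
    have had : a ≠ d := by simp only [List.nodup_cons, List.mem_cons] at hn; tauto
    exact G.classSum_top_bot_eq_of_pendant g a b c d hab hac had hpend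
  constructor
  · intro h V E _ _ G g a b c d hn hg hpend
    have := h G g a b c d hn hg hpend
    rw [key G g a b c d hn hpend] at this
    linarith
  · intro h V E _ _ G g a b c d hn hg hpend
    rw [key G g a b c d hn hpend]
    have := h G g a b c d hn hg hpend
    linarith

end PercRepro
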